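import Mathlib

/-!
# Tier4/Line1/FundamentalDomainOfCompact — the GENERIC reduction behind (I1-c), (I1-c′), (I1-c″) of LINE L1

Blind re-derivation cell `pub-hodge-repro`, Tier 4 (README §9–§10), seat t4-L1-p5 (prover, LINE L1, gen 0).
Mathlib only.  The compactness theorems (I1-c/c′/c″) of `Skeleton.lean` v0.8 (12c8528bc811170c…, L521–L541) ask, for
every Haar measure, a fundamental domain of the rational points with compact closure.  This file proves the
measure-theoretic half ONCE, for any discrete countable subgroup `Γ` of a Hausdorff topological group `G`: if a compact
`C ⊆ G` satisfies `Γ · C = G` («`Γ\G` is compact»), then for EVERY measure `μ` on `G` there is a measurable set `D ⊆ C`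
(so `closure D ⊆ C` is compact) which is an exact transversal of the left `Γ`-orbits, hence a Mathlib
`IsFundamentalDomain Γ D μ`.  The construction: pick an open `V ∋ 1` with `V V⁻¹ ∩ Γ = {1}` (discreteness), cover the
compact `C` by finitely many right translates `V x₁, …, V xₙ`, and let `D = ⋃ᵢ (V xᵢ ∩ C) ∖ Γ·⋃_{j<i} (V xⱼ ∩ C)`: the
`Γ`-orbit of any point meets `D` exactly once — in the piece of least index it meets, and only once there because two
points of `V xᵢ` in one `Γ`-orbit differ by an element of `V V⁻¹ ∩ Γ`.

What remains of (I1-c/c′/c″) after this file is PURELY TOPOLOGICAL: a compact `C` with `rationalPoints W · C = GA W`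
(Borel–Harish-Chandra / Godement for the definite plane; Fujisaki / Weil BNT IV §4 Thm 6 for the tori).

Nothing here says anything about the status of the Hodge conjecture for CM abelian varieties, which is NOT proved
(HC_CM is NOT proved by anyone in this repository).
-/

set_option autoImplicit false

noncomputable section

namespace Summit.Ventures.HodgeRepro.Tier4.Line1

open MeasureTheory Topology Set
open scoped Pointwise

section Generic

variable {G : Type*} [Group G] [TopologicalSpace G] [IsTopologicalGroup G]

/-- A discrete subgroup `Γ` of a topological group admits an open neighbourhood `V` of `1` with
`V V⁻¹ ∩ Γ = {1}`: if `a, b ∈ V` and `a b⁻¹ ∈ Γ` then `a = b`. -/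
theorem exists_open_nhds_one_of_discrete (Γ : Subgroup G) [DiscreteTopology Γ] :
    ∃ V : Set G, IsOpen V ∧ (1 : G) ∈ V ∧ ∀ a ∈ V, ∀ b ∈ V, a * b⁻¹ ∈ Γ → a = b := by
  have h1 : IsOpen ({1} : Set Γ) := isOpen_discrete _
  obtain ⟨U, hU, hU1⟩ := isOpen_induced_iff.1 h1
  have hU1' : (1 : G) ∈ U := by
    have : (1 : Γ) ∈ Subtype.val ⁻¹' U := by
      rw [hU1]
      exact Set.mem_singleton _
    exact this
  obtain ⟨V₀, hV₀, h1V₀, hV₀U⟩ := exists_open_nhds_one_split (hU.mem_nhds hU1')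
  refine ⟨V₀ ∩ V₀⁻¹, hV₀.inter hV₀.inv, ⟨h1V₀, by simpa using h1V₀⟩, ?_⟩
  rintro a ⟨ha, -⟩ b ⟨-, hb⟩ hab
  have hmem : a * b⁻¹ ∈ U := hV₀U a ha b⁻¹ (Set.mem_inv.1 hb)
  have hmem' : (⟨a * b⁻¹, hab⟩ : Γ) ∈ Subtype.val ⁻¹' U := hmem
  rw [hU1] at hmem'
  have h : a * b⁻¹ = 1 := congrArg Subtype.val (Set.mem_singleton_iff.1 hmem')
  exact mul_inv_eq_one.1 h

variable [T2Space G] [MeasurableSpace G] [BorelSpace G]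

/-- **The generic reduction.**  `Γ` a discrete countable subgroup of the Hausdorff topological group `G`, `C ⊆ G`
compact with `Γ · C = G`: for every measure `μ` on `G` there is a measurable `D ⊆ C` which is a fundamental domain
for the left action of `Γ` (every orbit meets `D` exactly once). -/
theorem exists_isFundamentalDomain_subset_of_isCompact (Γ : Subgroup G) [DiscreteTopology Γ]
    [Countable Γ] (μ : Measure G) {C : Set G} (hC : IsCompact C)
    (hcov : ∀ x : G, ∃ γ : Γ, ∃ c ∈ C, x = (γ : G) * c) :
    ∃ D : Set G, D ⊆ C ∧ MeasurableSet D ∧ IsFundamentalDomain Γ D μ := by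
  classical
  obtain ⟨V, hV, h1V, hVΓ⟩ := exists_open_nhds_one_of_discrete Γ
  -- the open cover of `C` by the right translates `V x`, `x ∈ C`, and a finite subcover
  have hcover : C ⊆ ⋃ x : C, (fun v => v * (x : G)) '' V := fun c hc =>
    Set.mem_iUnion.2 ⟨⟨c, hc⟩, ⟨1, h1V, one_mul c⟩⟩
  obtain ⟨t, ht⟩ := hC.elim_finite_subcover (fun x : C => (fun v => v * (x : G)) '' V)
    (fun x => (Homeomorph.mulRight (x : G)).isOpenMap V hV) hcover
  -- enumerate the finite subcover by `Fin n`
  let n := t.card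
  let x : Fin n → G := fun i => ((t.equivFin.symm i).1 : C)
  have hx : ∀ c ∈ C, ∃ i : Fin n, c ∈ (fun v => v * x i) '' V := by
    intro c hc
    obtain ⟨i, hi, hci⟩ := Set.mem_iUnion₂.1 (ht hc)
    refine ⟨t.equivFin ⟨i, hi⟩, ?_⟩
    have hxi : x (t.equivFin ⟨i, hi⟩) = (i : G) := by
      simp only [x, Equiv.symm_apply_apply]
    rw [hxi]
    exact hci
  -- the pieces
  let A : Fin n → Set G := fun i => ((fun v => v * x i) '' V) ∩ C
  have hAmeas : ∀ i, MeasurableSet (A i) := fun i =>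
    ((Homeomorph.mulRight (x i)).isOpenMap V hV).measurableSet.inter hC.isClosed.measurableSet
  have hAC : ∀ i, A i ⊆ C := fun i => Set.inter_subset_right
  let B : Fin n → Set G := fun i => ⋃ (j : Fin n) (_ : j < i), ⋃ γ : Γ, (γ : G) • A j
  have hBmeas : ∀ i, MeasurableSet (B i) := fun i =>
    MeasurableSet.iUnion fun j => MeasurableSet.iUnion fun _ => MeasurableSet.iUnion fun γ =>
      (hAmeas j).const_smul (γ : G)
  have hmemB : ∀ i (z : G), z ∈ B i ↔ ∃ j : Fin n, j < i ∧ ∃ γ : Γ, (γ : G)⁻¹ * z ∈ A j := by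
    intro i z
    simp only [B, Set.mem_iUnion, mem_smul_set_iff_inv_smul_mem, smul_eq_mul]
    exact ⟨fun ⟨j, hj, γ, h⟩ => ⟨j, hj, γ, h⟩, fun ⟨j, hj, γ, h⟩ => ⟨j, hj, γ, h⟩⟩
  let D : Set G := ⋃ i, A i \ B i
  have hDmeas : MeasurableSet D := MeasurableSet.iUnion fun i => (hAmeas i).diff (hBmeas i)
  refine ⟨D, Set.iUnion_subset fun i => Set.sdiff_subset.trans (hAC i), hDmeas, ?_⟩
  refine IsFundamentalDomain.mk' hDmeas.nullMeasurableSet ?_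
  intro y
  -- the orbit of `y` meets some piece: pick the least index
  have hP : ∃ m : ℕ, ∃ hm : m < n, ∃ γ : Γ, (γ : G) * y ∈ A ⟨m, hm⟩ := by
    obtain ⟨γ₀, c, hc, rfl⟩ := hcov y
    obtain ⟨i, hi⟩ := hx c hc
    refine ⟨i.1, i.2, γ₀⁻¹, ?_⟩
    have : ((γ₀⁻¹ : Γ) : G) * ((γ₀ : G) * c) = c := by
      rw [Subgroup.coe_inv, inv_mul_cancel_left]
    rw [this]
    exact ⟨hi, hc⟩
  let i₀ : Fin n := ⟨Nat.find hP, (Nat.find_spec hP).1⟩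
  obtain ⟨γ₁, hγ₁⟩ := (Nat.find_spec hP).2
  have hγ₁A : (γ₁ : G) * y ∈ A i₀ := hγ₁
  have hγ₁B : (γ₁ : G) * y ∉ B i₀ := by
    intro hB
    obtain ⟨j, hj, γ', hmem⟩ := (hmemB i₀ _).1 hB
    have hjlt : j.1 < Nat.find hP := hj
    refine Nat.find_min hP hjlt ⟨j.2, γ'⁻¹ * γ₁, ?_⟩
    have : ((γ'⁻¹ * γ₁ : Γ) : G) * y = (γ' : G)⁻¹ * ((γ₁ : G) * y) := by
      rw [Subgroup.coe_mul, Subgroup.coe_inv, mul_assoc]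
    rw [this]
    exact hmem
  have hD : ∀ γ : Γ, γ • y ∈ D ↔ ∃ i : Fin n, (γ : G) * y ∈ A i ∧ (γ : G) * y ∉ B i := by
    intro γ
    simp only [D, Set.mem_iUnion, Set.mem_sdiff]
    rfl
  refine ⟨γ₁, (hD γ₁).2 ⟨i₀, hγ₁A, hγ₁B⟩, ?_⟩
  -- uniqueness
  intro γ₂ hγ₂
  obtain ⟨i₂, hA₂, hB₂⟩ := (hD γ₂).1 hγ₂
  -- the two indices agree
  have hi : i₂ = i₀ := by
    rcases lt_trichotomy i₂ i₀ with hlt | heq | hgt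
    · exact absurd ((hmemB i₀ _).2 ⟨i₂, hlt, γ₁ * γ₂⁻¹, by
        have : ((γ₁ * γ₂⁻¹ : Γ) : G)⁻¹ * ((γ₁ : G) * y) = (γ₂ : G) * y := by
          rw [Subgroup.coe_mul, Subgroup.coe_inv, mul_inv_rev, inv_inv, mul_assoc,
            inv_mul_cancel_left]
        rw [this]
        exact hA₂⟩) hγ₁B
    · exact heq
    · exact absurd ((hmemB i₂ _).2 ⟨i₀, hgt, γ₂ * γ₁⁻¹, by
        have : ((γ₂ * γ₁⁻¹ : Γ) : G)⁻¹ * ((γ₂ : G) * y) = (γ₁ : G) * y := by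
          rw [Subgroup.coe_mul, Subgroup.coe_inv, mul_inv_rev, inv_inv, mul_assoc,
            inv_mul_cancel_left]
        rw [this]
        exact hγ₁A⟩) hB₂
  rw [hi] at hA₂ hB₂
  -- both lie in the same translate `V x`, so they differ by an element of `V V⁻¹ ∩ Γ = {1}`
  obtain ⟨v₁, hv₁, hv₁y⟩ := hγ₁A.1
  obtain ⟨v₂, hv₂, hv₂y⟩ := hA₂.1
  have hvv : v₁ * v₂⁻¹ ∈ Γ := by
    have e : v₁ * v₂⁻¹ = ((γ₁ * γ₂⁻¹ : Γ) : G) := by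
      rw [Subgroup.coe_mul, Subgroup.coe_inv]
      have h1 : v₁ = (γ₁ : G) * y * (x i₀)⁻¹ := by
        rw [← hv₁y]
        simp only [mul_inv_cancel_right]
      have h2 : v₂ = (γ₂ : G) * y * (x i₀)⁻¹ := by
        rw [← hv₂y]
        simp only [mul_inv_cancel_right]
      rw [h1, h2]
      group
    rw [e]
    exact Subtype.mem _
  have hv : v₁ = v₂ := hVΓ v₁ hv₁ v₂ hv₂ hvv
  have hy : (γ₂ : G) * y = (γ₁ : G) * y := by rw [← hv₁y, ← hv₂y, hv]
  exact Subtype.ext (mul_right_cancel hy)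

/-- The same, packaged as in (I1-c): a fundamental domain with compact closure. -/
theorem exists_isFundamentalDomain_isCompact_closure_of_isCompact (Γ : Subgroup G)
    [DiscreteTopology Γ] [Countable Γ] (μ : Measure G) {C : Set G} (hC : IsCompact C)
    (hcov : ∀ x : G, ∃ γ : Γ, ∃ c ∈ C, x = (γ : G) * c) :
    ∃ D : Set G, IsFundamentalDomain Γ D μ ∧ IsCompact (closure D) := by
  obtain ⟨D, hDC, -, hD⟩ := exists_isFundamentalDomain_subset_of_isCompact Γ μ hC hcov
  exact ⟨D, hD, hC.closure_of_subset hDC⟩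

end Generic

end Summit.Ventures.HodgeRepro.Tier4.Line1

end
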